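import Summits.BirchSwinnertonDyer.Rank1Residual.AdditivePotMult.QuadraticBaseChangeDefectOverC
import Summits.BirchSwinnertonDyer.Rank1Residual.AdditivePotMult.TwistSupplyOddDiscr
import HarnessLib

/-!
# X4(M)⁰ one-sided, WITHOUT MILNE: `BSD(E,p)` from ONE inequality over the quadratic fields
# (`MissingLowerBoundOverCAt (W.baseChange K) p`, Kim's upper half over `ℚ`) — additive-p1's
# `bsdp_of_classX4M_of_lowerOverC_of_kim` / `bsdp_of_classX4M_of_ram_of_lowerOverC_of_kim` with
# `{hMilneC} ↦ ∅` (row T-MIL-UNI, FILE U-6; seat n1011-p01 GEN 10)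

HONEST FRAMING (cell `b2b-bsdres`, run/shared/lean/b2b/bsd-rank1-residual/, verbatim in every
file): the goal of the cell is to DELETE the COMBINATION-SHAPED residual classes of the
Birch–Swinnerton-Dyer formula for ALL analytic-rank `≤ 1` elliptic curves over `ℚ` — "full BSD
formula for every rank `≤ 1` curve in class `C`" assembled STRICTLY from published theorems — so
that the rank-`≤ 1` remainder becomes exactly the CONSTRUCTION-SHAPED classes, which are TYPED
(missing-input `Prop`s), NOT attempted. This is not "finishing BSD". Sub-classes X3♯(M) / X4(M)
(additive, potentially multiplicative prime; base-change-and-descend): a RESEARCH ROUTE; they stay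
CONSTRUCTION-SHAPED; nothing is booked by this file; no mark / label moved. THEOREMS ONLY: no
definition, no named fact, no `sorry`.

## What (row T-MIL-UNI, FILE U-6)

additive-p1's ONE-SIDED class theorems for X4(M)⁰ ∩ {`r_an(E) = 0`, `p ≥ 5`, `ρ̄_{E,p}` onto,
`p ∤ c_D · ∏ c_ℓ(E)`} (`ModelFreeClassTheorems.bsdp_of_classX4M_of_lowerOverC_of_kim`, with a GIVEN
rank-zero (ram) `p`-multiplicative twist, and `TwistSupplyX4.bsdp_of_classX4M_of_ram_of_lowerOverC_of_kim`,
uniform over X4(M) ∧ (ram)) take the upper half over `ℚ` from Kim 2026 Thm. 1.8 (6) (`hKim`, via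
additive-p4's `X4RankZero.bsdp_of_missingLowerBoundAt`), the twist from Skinner 2016 Thm. C (`hSk`),
and the transport of the LOWER half down from `K` from Milne's identity `hMilneC` (A73). FILE U-5's
`missingLowerBoundAt_iff_overC_noMilne` transports the half WITHOUT Milne on the population of FILE
U-2, so:

* `bsdp_of_classX4M_of_lowerOverC_of_kim_noMilne` — the given-twist theorem with `hMilneC` REPLACED
  by `d_K` odd squarefree, `p ∣ d_K` and H-4b's population `hS` (theorems on FILE U-3's supply);
* **`bsdp_of_classX4M_of_ram_of_lowerOverC_of_kim_noMilne`** — the UNIFORM theorem on X4(M) ∧ (ram):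
  additive-p1's `bsdp_of_classX4M_of_ram_of_lowerOverC_of_kim` with binder diff EXACTLY
  `{hMilneC} ↦ ∅` (FILE U-3's odd-discriminant supply in place of `ClassX4M.exists_ram_rankZero_mult_twist`);
* `missingUpperBoundOverCAt_of_classX4M_of_kim_noMilne` — conversely, on those rows the UPPER half
  on `W ⊗ K` already HOLDS (Kim's bound transported up by FILE U-5's
  `missingUpperBoundAt_iff_overC_noMilne`): the lower half is all that can be missing.

HONEST LIMITS: the rows of the originals (rank `0`, `p ≥ 5`, surjective `ρ̄`, Manin and Tamagawa
units, (ram)); the remaining inequality `ord_p #Ш_an(E_K/K) ≤ ord_p #Ш(E_K/K)` (Skinner–Urban / Wan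
direction over `K` at a multiplicative prime with `p ∣ d_K`) is printed nowhere; X4(M) stays
CONSTRUCTION-SHAPED; closes no class; moves no mark; 0 facts.

References: C.-H. Kim, *The structure of Selmer groups…* Thm. 1.8 (6) [Kim2022StructureSelmer];
C. Skinner, Pacific J. Math. 283 (2016) Thm. C [Skinner2016PacificMC]; J. S. Milne, Invent. Math. 17
(1972) §1 Thm. 1 [Milne1972ArithmeticAV] (the fact REMOVED); T. Dokchitser, V. Dokchitser, Ann. of
Math. 172 (2010) §2.1 [DokchitserDokchitserAnnals2010].
-/

noncomputable section

open scoped Classical NumberField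

open WeierstrassCurve NumberField IsDedekindDomain Rat.HeightOneSpectrum
  Literature.NumberTheory.EllipticCurves Literature.NumberTheory.EllipticCurves.ModularForms
  Literature.NumberTheory.EllipticCurves.Rank1Residual
  Literature.NumberTheory.EllipticCurves.Rank1Residual.Typed
  Literature.NumberTheory.DiophantineGeometry

namespace Summit.BirchSwinnertonDyer.Rank1Residual.AdditivePotMult

section OneSidedNoMilne

variable (W : WeierstrassCurve ℚ) [W.IsElliptic] [W.IsGloballyMinimal] (p : ℕ) [hp : Fact p.Prime]
  (K : Type) [Field K] [NumberField K]
  (Wd : WeierstrassCurve ℚ) [Wd.IsElliptic] [Wd.IsGloballyMinimal]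

/-- **X4(M)⁰ ∩ {`r_an = 0`, `p ≥ 5`, `ρ̄` onto, `p ∤ c_D·∏c_ℓ`}, model-free, one-sided, WITHOUT MILNE**:
given a quadratic `K` with `d_K` odd squarefree, `p ∣ d_K`, whose twist `W_d = C_d • W^{(d_K)}`
(globally minimal) is multiplicative at `p`, (ram), of analytic rank `0`, and `W` on H-4b's
population `hS`: `MissingLowerBoundOverCAt (W.baseChange K) p → BSDp W p` — the upper half over `ℚ`
being Kim 2026 Thm. 1.8 (6) (= arXiv v4 Thm. 1.9 (6); printed for `p ≥ 5`, whence the inherited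
binder `hp5`) (`hKim`, additive-p4's `X4RankZero.bsdp_of_missingLowerBoundAt`), the
twist Skinner 2016 Thm. C (`hSk`), and the transport of the lower half FILE U-5's
`missingLowerBoundAt_iff_overC_noMilne` (additive-p1's `bsdp_of_classX4M_of_lowerOverC_of_kim` with
`hMilneC` REPLACED by the population hypotheses). [cite: Kim2022StructureSelmer, Thm. 1.9 (6) (PDF p. 8)]
[cite: Skinner2016PacificMC, Thm. C (§1), footnote 1, §2.5] -/
theorem bsdp_of_classX4M_of_lowerOverC_of_kim_noMilne
    (hKim : Kim2026.rankZero_padicValNat_sha_le_of_maninConstant)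
    (hGZK : rank_eq_analyticRank_of_analyticRank_le_one) (hmod : hasEntireLFunction_rat)
    (hSk : Skinner2016.thmC_padicValRat_bsd_rank_zero)
    (hX : ClassX4M W p) (hp5 : 5 ≤ p) (hrW : W.analyticRank = 0) (hsurj : Surj W p)
    {N : ℕ} [NeZero N] (D : ModularParametrizationData W N) (hc : ¬ (p : ℤ) ∣ D.maninConstant)
    (htam : ¬ p ∣ W.tamagawaProduct) (h2 : Module.finrank ℚ K = 2)
    (hdodd : Odd (NumberField.discr K)) (hdsq : Squarefree (NumberField.discr K))
    (hpd : (p : ℤ) ∣ NumberField.discr K)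
    {Cd : VariableChange ℚ} (hWd : Cd • W.quadraticTwist (NumberField.discr K : ℚ) = Wd)
    (hmult : Mult Wd p) (hram : Ram Wd p) (hr0 : Wd.analyticRank = 0)
    (hS : ∀ v : HeightOneSpectrum (𝓞 ℚ), W.HasGoodReductionAt v ∨ W.HasMultiplicativeReductionAt v ∨
      (((primesEquiv v : ℕ) : ℤ) ∣ NumberField.discr K ∧ Wd.HasMultiplicativeReductionAt v) ∨
      (W.HasAdditiveReductionAt v ∧ ¬ ((primesEquiv v : ℕ) : ℤ) ∣ NumberField.discr K ∧
        (p = 3 → (primesEquiv v : ℕ) ≠ 3)))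
    (hlow : MissingLowerBoundOverCAt (W.baseChange K) p) : BSDp W p := by
  have hD : (NumberField.discr K : ℚ) ≠ 0 := by exact_mod_cast NumberField.discr_ne_zero K
  obtain ⟨hp2, -, hirrd⟩ := mult_irr_twist_of_classX4M hX hD ⟨Cd, hWd⟩ hmult
  have hd : BSDp Wd p := bsdp_twist_of_rankZero_ram p Wd hSk hGZK hmod hp2 hmult hirrd hram hr0
  obtain ⟨-, hfinW⟩ := hGZK W (by rw [hrW]; exact zero_le_one)
  obtain ⟨-, hfinD⟩ := hGZK Wd (by rw [hr0]; exact zero_le_one)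
  have hlowQ : MissingLowerBoundAt W p :=
    (missingLowerBoundAt_iff_overC_noMilne W p K Wd hmod h2 hdodd hdsq hpd hWd hp2 hmult hS hfinW hfinD
      hd).mpr hlow
  exact Additive.X4RankZero.bsdp_of_missingLowerBoundAt W p hKim hGZK hmod hp5 hrW hX.1 hsurj D hc
    htam hlowQ

/-- **Conversely, on the same rows the lower half over `K` is all that can be missing, WITHOUT MILNE**:
the UPPER half `MissingUpperBoundOverCAt (W.baseChange K) p` HOLDS, by Kim's upper bound over `ℚ`
(additive-p4's `X4RankZero.missingUpperBoundAt`) transported up by FILE U-5's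
`missingUpperBoundAt_iff_overC_noMilne`. [cite: Kim2022StructureSelmer, Thm. 1.9 (6) (PDF p. 8)]
[cite: Skinner2016PacificMC, Thm. C (§1), footnote 1, §2.5] -/
theorem missingUpperBoundOverCAt_of_classX4M_of_kim_noMilne
    (hKim : Kim2026.rankZero_padicValNat_sha_le_of_maninConstant)
    (hGZK : rank_eq_analyticRank_of_analyticRank_le_one) (hmod : hasEntireLFunction_rat)
    (hSk : Skinner2016.thmC_padicValRat_bsd_rank_zero)
    (hX : ClassX4M W p) (hp5 : 5 ≤ p) (hrW : W.analyticRank = 0) (hsurj : Surj W p)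
    {N : ℕ} [NeZero N] (D : ModularParametrizationData W N) (hc : ¬ (p : ℤ) ∣ D.maninConstant)
    (htam : ¬ p ∣ W.tamagawaProduct) (h2 : Module.finrank ℚ K = 2)
    (hdodd : Odd (NumberField.discr K)) (hdsq : Squarefree (NumberField.discr K))
    (hpd : (p : ℤ) ∣ NumberField.discr K)
    {Cd : VariableChange ℚ} (hWd : Cd • W.quadraticTwist (NumberField.discr K : ℚ) = Wd)
    (hmult : Mult Wd p) (hram : Ram Wd p) (hr0 : Wd.analyticRank = 0)
    (hS : ∀ v : HeightOneSpectrum (𝓞 ℚ), W.HasGoodReductionAt v ∨ W.HasMultiplicativeReductionAt v ∨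
      (((primesEquiv v : ℕ) : ℤ) ∣ NumberField.discr K ∧ Wd.HasMultiplicativeReductionAt v) ∨
      (W.HasAdditiveReductionAt v ∧ ¬ ((primesEquiv v : ℕ) : ℤ) ∣ NumberField.discr K ∧
        (p = 3 → (primesEquiv v : ℕ) ≠ 3))) :
    MissingUpperBoundOverCAt (W.baseChange K) p := by
  have hD : (NumberField.discr K : ℚ) ≠ 0 := by exact_mod_cast NumberField.discr_ne_zero K
  obtain ⟨hp2, -, hirrd⟩ := mult_irr_twist_of_classX4M hX hD ⟨Cd, hWd⟩ hmult
  have hd : BSDp Wd p := bsdp_twist_of_rankZero_ram p Wd hSk hGZK hmod hp2 hmult hirrd hram hr0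
  obtain ⟨-, hfinW⟩ := hGZK W (by rw [hrW]; exact zero_le_one)
  obtain ⟨-, hfinD⟩ := hGZK Wd (by rw [hr0]; exact zero_le_one)
  have hup : MissingUpperBoundAt W p :=
    Additive.X4RankZero.missingUpperBoundAt W p hKim hGZK hmod hp5 hrW hX.1 hsurj D hc htam
  exact (missingUpperBoundAt_iff_overC_noMilne W p K Wd hmod h2 hdodd hdsq hpd hWd hp2 hmult hS hfinW
    hfinD hd).mp hup

end OneSidedNoMilne

section UniformNoMilne

variable {W : WeierstrassCurve ℚ} [W.IsElliptic] {p : ℕ} [Fact p.Prime]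

/-- **X4(M) ∧ (ram) ∩ {`r_an(E) = 0`, `p ≥ 5`, `ρ̄_{E,p}` onto, `p ∤ c_D`, `p ∤ ∏ c_ℓ(E)`}: `BSD(E,p)`
from ONE inequality over the quadratic fields, uniformly, WITHOUT MILNE.** If
`MissingLowerBoundOverCAt (W.baseChange K) p` (`ord_p #Ш_an(E_K/K) ≤ ord_p #Ш(E_K/K)` on the
base-changed model) holds for every quadratic field `K` whose twist `E^{(d_K)}` (globally minimal
model `W_d`) is multiplicative at `p`, then `BSD(E,p)` — additive-p1's
`TwistSupplyX4.bsdp_of_classX4M_of_ram_of_lowerOverC_of_kim` with the binder `hMilneC` (Milne 1972,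
A73) REMOVED, everything else identical: the twist is FILE U-3's odd-discriminant (ram) rank-zero twist,
the rest `bsdp_of_classX4M_of_lowerOverC_of_kim_noMilne`. [cite: Kim2022StructureSelmer, Thm. 1.9 (6) (PDF p. 8)]
[cite: Skinner2016PacificMC, Thm. C (§1), footnote 1, §2.5]
[cite: HoffsteinLuo1997, Theorem (§1, pp. 435–436)] -/
theorem bsdp_of_classX4M_of_ram_of_lowerOverC_of_kim_noMilne [W.IsGloballyMinimal]
    (hKim : Kim2026.rankZero_padicValNat_sha_le_of_maninConstant)
    (hGZK : rank_eq_analyticRank_of_analyticRank_le_one) (hmod : hasEntireLFunction_rat)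
    (hSk : Skinner2016.thmC_padicValRat_bsd_rank_zero)
    (hnf : exists_isNewformOf) (hHL : HoffsteinLuo1997_exists_twist_L_one_ne_zero)
    (hX : ClassX4M W p) (hram : Ram W p) (hp5 : 5 ≤ p) (hrW : W.analyticRank = 0)
    (hsurj : Surj W p) {N : ℕ} [NeZero N] (D : ModularParametrizationData W N)
    (hc : ¬ (p : ℤ) ∣ D.maninConstant) (htam : ¬ p ∣ W.tamagawaProduct)
    (hK : ∀ (K : Type) [Field K] [NumberField K] (Wd : WeierstrassCurve ℚ) [Wd.IsElliptic]
      [Wd.IsGloballyMinimal], Module.finrank ℚ K = 2 →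
      (∃ C : VariableChange ℚ, C • W.quadraticTwist (NumberField.discr K : ℚ) = Wd) →
      Mult Wd p → MissingLowerBoundOverCAt (W.baseChange K) p) :
    BSDp W p := by
  obtain ⟨K, iF, iN, Wd, iWd, iWdm, Cd, h2, hodd, hsq, hpd, hWd, hmult, -, hr0, hS, hramT⟩ :=
    hX.exists_rankZero_mult_twist_oddDiscr hnf hHL
  exact bsdp_of_classX4M_of_lowerOverC_of_kim_noMilne W p K Wd hKim hGZK hmod hSk hX hp5 hrW hsurj D hc
    htam h2 hodd hsq hpd hWd hmult (hramT hram) hr0 hS (hK K Wd h2 ⟨Cd, hWd⟩ hmult)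

end UniformNoMilne

end Summit.BirchSwinnertonDyer.Rank1Residual.AdditivePotMult

end
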